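import Literature.NumberTheory.GaloisRepresentations.TameInertiaKummerProofs
import HarnessLib

/-!
# Continuous homomorphisms from the inertia group `I_F` of a local field to a group of exponent `d` prime to
# the residue characteristic form a FINITE set (tame inertia is pro-cyclic; proved, no definition, no named fact)

Topic `NumberTheory/GaloisRepresentations` (namespace = path). THEOREMS ONLY. Written by the `bsd-2adic` cell (seat
`bsd-2adic-t42` GEN 36) as the local brick (B3, "pro-`p` tame inertia at the places over `S₀`") of the bridge
«Oukhaba–Viguié 2016 + Greenberg 1978 ⟹ the GL(1) leaf `TrivialCharSplitLineFiniteAt` of crux O2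
(stmt-BirchSwinnertonDyer-24728)»: the `S₀`-imprimitive Selmer condition of a TRIVIAL-action module `M` at a place
`𝔮 ∤ p` of `K_∞` is read on the restriction of a continuous homomorphism `Gal(K̄/K_∞) → M[p]` to an inertia group
above `𝔮`, and there are only finitely many such restrictions.

* `finite_setOf_continuous_mulToAdd_torsion_absInertia` — for a non-archimedean local field `F` with residue
  characteristic `ℓ`, an abelian group `M` with the discrete topology and `d` with `ℓ ∤ d` such that
  `M[d] = {m | d·m = 0}` is finite: **the set of continuous maps `g : I_F → M` with `g(xy) = g x + g y` and `d·g = 0`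
  is finite** (of cardinality `≤ #M[d]`). Proof (Serre, *Local Fields* IV §2 Cor. 1 and Cor. 3 of Prop. 7, in the
  tree's form `absInertia_exists_eq_mul_zpow`: tame quotients of `I_F` of exponent prime to `ℓ` are cyclic): for a
  FINITE family `T` of such maps the common kernel `N` is open in `I_F` (continuity, `M` discrete), contains the
  `d`-th powers and the elements restricting trivially to some finite Galois `E/F`
  (`exists_isGalois_mem_of_restrict_eq_one`); hence `I_F = N·⟨g₀⟩` and `g ↦ g(g₀) ∈ M[d]` is injective on `T`, so
  `#T ≤ #M[d]`; a set all of whose finite subsets have at most `#M[d]` elements is finite.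
* private helpers (`MulToAdd.…`) for maps `g : G → M` with `g(xy) = g x + g y`.

HONEST FRAMING: local Galois bookkeeping; nothing about any curve or Selmer group is asserted; BSD is proved for no
curve by this.

References: J.-P. Serre, *Local Fields* (1979), Ch. IV §2, Prop. 7 Cor. 1 (`G_0/G_1` cyclic of order prime to `p`)
and Cor. 3 (`G_1` a `p`-group) [SerreLocalFields1979]; J.-P. Serre, Invent. Math. 15 (1972) §1.3 Prop. 2
(`I_t = lim← μ_d`) [SerreInventiones1972]; J. Neukirch, A. Schmidt, K. Wingberg, *Cohomology of Number Fields*,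
(7.5.2) [NeukirchSchmidtWingberg2008].
-/

noncomputable section

open ValuativeRel Field
open scoped Pointwise Valued

namespace Literature.NumberTheory.GaloisRepresentations

open GaloisRepresentations.IsNonarchimedeanLocalField

/-! ## §1 Maps `g : G → M` with `g (x * y) = g x + g y` -/

namespace MulToAdd

variable {G : Type*} [Group G] {M : Type*} [AddCommGroup M] {g : G → M}

/-- `g 1 = 0`. [folklore] -/
private theorem map_one (hg : ∀ x y, g (x * y) = g x + g y) : g 1 = 0 := by
  have h := hg 1 1
  rw [mul_one] at h
  exact left_eq_add.mp h

/-- `g x⁻¹ = - g x`. [folklore] -/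
private theorem map_inv (hg : ∀ x y, g (x * y) = g x + g y) (x : G) : g x⁻¹ = -g x := by
  have h := hg x x⁻¹
  rw [mul_inv_cancel, map_one hg] at h
  exact (neg_eq_of_add_eq_zero_right h.symm).symm

/-- `g (x ^ n) = n • g x` for `n : ℕ`. [folklore] -/
private theorem map_pow_nat (hg : ∀ x y, g (x * y) = g x + g y) (x : G) (n : ℕ) : g (x ^ n) = n • g x := by
  induction n with
  | zero => rw [pow_zero, zero_smul, map_one hg]
  | succ n ih => rw [pow_succ, hg, ih, succ_nsmul]

/-- `g (x ^ n) = n • g x` for `n : ℤ`. [folklore] -/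
private theorem map_zpow (hg : ∀ x y, g (x * y) = g x + g y) (x : G) (n : ℤ) : g (x ^ n) = n • g x := by
  cases n with
  | ofNat n => rw [Int.ofNat_eq_natCast, zpow_natCast, natCast_zsmul, map_pow_nat hg]
  | negSucc n => rw [zpow_negSucc, map_inv hg, map_pow_nat hg, negSucc_zsmul]

end MulToAdd

/-! ## §2 Finiteness of the `d`-torsion homomorphisms on `I_F` -/

section Local

variable (F : Type*) [Field F] [ValuativeRel F] [TopologicalSpace F] [IsNonarchimedeanLocalField F]
variable (M : Type*) [AddCommGroup M] [TopologicalSpace M] [DiscreteTopology M]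

/-- **The continuous homomorphisms `I_F → M` killed by `d`, `ℓ ∤ d`, form a finite set** (at most `#M[d]`
of them): tame quotients of `I_F` of exponent prime to the residue characteristic `ℓ` are cyclic
(`absInertia_exists_eq_mul_zpow`), so every finite family of such maps is separated by the values at ONE
element `g₀ ∈ I_F`, which lie in the finite set `M[d]`.
[cite: SerreLocalFields1979, Ch. IV §2 Cor. 1 and Cor. 3 of Prop. 7] [cite: SerreInventiones1972, §1.3 Prop. 2] -/
theorem finite_setOf_continuous_mulToAdd_torsion_absInertia {d : ℕ} (hd : ¬ ringChar 𝓀[F] ∣ d)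
    (hMd : {m : M | d • m = 0}.Finite) :
    Set.Finite {g : ↥(absInertia F) → M |
      Continuous g ∧ (∀ x y, g (x * y) = g x + g y) ∧ ∀ x, d • g x = 0} := by
  classical
  set S : Set (↥(absInertia F) → M) :=
    {g | Continuous g ∧ (∀ x y, g (x * y) = g x + g y) ∧ ∀ x, d • g x = 0} with hS
  -- every finite subfamily has at most `#M[d]` members
  have key : ∀ T : Finset (↥(absInertia F) → M), ↑T ⊆ S → T.card ≤ hMd.toFinset.card := by
    intro T hT
    -- the common kernel (each `g ∈ T` read as a homomorphism to `Multiplicative M`)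
    let φ : T → (↥(absInertia F) →* Multiplicative M) := fun g =>
      { toFun := fun x => Multiplicative.ofAdd (g.1 x)
        map_one' := by rw [MulToAdd.map_one (hT g.2).2.1]; rfl
        map_mul' := fun x y => by rw [(hT g.2).2.1]; rfl }
    let N : Subgroup ↥(absInertia F) := ⨅ g : T, (φ g).ker
    have hNmem : ∀ x, x ∈ N ↔ ∀ g : T, g.1 x = 0 := fun x => by
      simp only [N, Subgroup.mem_iInf, MonoidHom.mem_ker]
      exact forall_congr' fun g => Iff.rfl
    -- `N` contains the `d`-th powers
    have hNd : ∀ τ : ↥(absInertia F), τ ^ d ∈ N := fun τ => by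
      rw [hNmem]
      intro g
      rw [MulToAdd.map_pow_nat (hT g.2).2.1]
      exact (hT g.2).2.2 τ
    -- `N` is open in `I_F`, hence the trace of an open subset `U` of `Γ_F`
    have hNopen : IsOpen (N : Set ↥(absInertia F)) := by
      have e : (N : Set ↥(absInertia F)) = ⋂ g : T, g.1 ⁻¹' {0} := by
        ext x
        rw [SetLike.mem_coe, hNmem, Set.mem_iInter]
        rfl
      rw [e]
      exact isOpen_iInter_of_finite fun g => (isOpen_discrete {(0 : M)}).preimage (hT g.2).1
    obtain ⟨U, hU, hUN⟩ := isOpen_induced_iff.mp hNopen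
    have h1U : (1 : absoluteGaloisGroup F) ∈ U := by
      have h1 : (1 : ↥(absInertia F)) ∈ Subtype.val ⁻¹' U := by rw [hUN]; exact N.one_mem
      exact h1
    obtain ⟨E, hEfin, hEgal, hE⟩ := exists_isGalois_mem_of_restrict_eq_one F hU h1U
    haveI := hEfin
    haveI := hEgal
    have hNE : ∀ τ : ↥(absInertia F), absRestrictNormalHom E (τ : absoluteGaloisGroup F) = 1 → τ ∈ N := by
      intro τ hτ
      have hτU : τ ∈ Subtype.val ⁻¹' U := hE τ hτ
      rw [hUN] at hτU
      exact hτU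
    -- tame quotients are cyclic: `I_F = N · ⟨g₀⟩`
    obtain ⟨g₀, hg₀⟩ := absInertia_exists_eq_mul_zpow F hd N hNd E hNE
    -- `g ↦ g g₀ ∈ M[d]` is injective on `T`
    let val : T → hMd.toFinset := fun g => ⟨g.1 g₀, by
      rw [Set.Finite.mem_toFinset]; exact (hT g.2).2.2 g₀⟩
    have hinj : Function.Injective val := by
      intro g g' hgg'
      have hv : g.1 g₀ = g'.1 g₀ := congrArg (fun m : hMd.toFinset => (m : M)) hgg'
      apply Subtype.ext
      funext σ
      obtain ⟨n, ν, hν, rfl⟩ := hg₀ σ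
      have hνg : g.1 ν = 0 := (hNmem ν).mp hν g
      have hνg' : g'.1 ν = 0 := (hNmem ν).mp hν g'
      rw [(hT g.2).2.1, (hT g'.2).2.1, hνg, hνg', MulToAdd.map_zpow (hT g.2).2.1,
        MulToAdd.map_zpow (hT g'.2).2.1, hv]
    have h := Fintype.card_le_of_injective val hinj
    rwa [Fintype.card_coe, Fintype.card_coe] at h
  -- a set all of whose finite subsets are bounded is finite
  by_contra hinf
  obtain ⟨T, hTS, hTcard⟩ := Set.Infinite.exists_subset_card_eq hinf (hMd.toFinset.card + 1)
  have := key T hTS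
  omega

end Local

end Literature.NumberTheory.GaloisRepresentations

end
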